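import Summits.CriticalPhenomena.PercolationContinuityZ3.Theorems.PercNearOneGluingNoHeavyLowerTailSahiOneStepCone
import HarnessLib

/-!
# One-step scheme: weighted-majority events (structure lemmas)

Support file (prover prim-ineq-prove-3 gen 30; `--supports stmt-CriticalPhenomena-4575`; memo
`run/shared/lean/prim/prim-ineq-prove-3/FINDING-G30-SHIFTED-PAIRS.md`).  No definitions, no named facts, no sorries, no `native_decide`.

The weighted-majority event `{ω | θ ≤ Σ_{i ∈ F ∩ ω} w_i}` (a complete simple game on `F`) is increasing for nonnegative weights
(`isUpperSet_weightedMajority`), determined by `F` (`determinedBy_weightedMajority`), and closed under every trade `ω ↦ (ω ∖ {x}) ∪ {y}` of a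
present coordinate for an absent one of no smaller weight (`tradeClosed_weightedMajority`) — i.e. SHIFTED w.r.t. any ranking along which the
weights do not decrease.  Used by `…SahiOneStepShiftedPairs` (THEOREMS S/S′) and `…SahiOneStepShiftedPartner` (THEOREM SP).
-/

noncomputable section

namespace Summit.CriticalPhenomena.PercolationContinuityZ3.Theorems

namespace SahiOneStep

open Finset
open Literature.Probability.Percolation (DeterminedBy determinedBy_iff)
open scoped Classical

variable {ι : Type*}

/-- A weighted-majority event with nonnegative weights is increasing. [folklore] -/
theorem isUpperSet_weightedMajority (F : Finset ι) {w : ι → ℝ} (hw : ∀ i ∈ F, 0 ≤ w i) (θ : ℝ) :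
    IsUpperSet {ω : Set ι | θ ≤ ∑ i ∈ F.filter (· ∈ ω), w i} := by
  intro ω ω' hle hω
  simp only [Set.mem_setOf_eq] at hω ⊢
  refine hω.trans (Finset.sum_le_sum_of_subset_of_nonneg (fun i hi => ?_) (fun i hi _ => hw i (Finset.mem_filter.1 hi).1))
  rw [Finset.mem_filter] at hi ⊢
  exact ⟨hi.1, hle hi.2⟩

/-- A weighted-majority event on `F` is determined by `F`. [folklore] -/
theorem determinedBy_weightedMajority (F : Finset ι) (w : ι → ℝ) (θ : ℝ) :
    DeterminedBy {ω : Set ι | θ ≤ ∑ i ∈ F.filter (· ∈ ω), w i} (↑F : Set ι) := by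
  rw [determinedBy_iff]
  intro ω ω' h
  have hf : F.filter (· ∈ ω) = F.filter (· ∈ ω') := by
    ext i
    simp only [Finset.mem_filter, and_congr_right_iff]
    intro hi
    have h1 := Set.ext_iff.1 h i
    simp only [Set.mem_inter_iff, Finset.mem_coe] at h1
    exact ⟨fun hω => (h1.1 ⟨hω, hi⟩).1, fun hω' => (h1.2 ⟨hω', hi⟩).1⟩
  simp only [Set.mem_setOf_eq, hf]

/-- **Trading a present coordinate for an absent one of no smaller weight keeps a weighted majority.**  For a relation `R` on `F` along which
the weights do not decrease (`R x y ⟹ w x ≤ w y`), the event `[Σ_{F∩ω} w ≥ θ]` is closed under the trades `ω ↦ (ω ∖ {x}) ∪ {y}`. [folklore] -/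
theorem tradeClosed_weightedMajority (F : Finset ι) {w : ι → ℝ} {R : ι → ι → Prop} (hmono : ∀ x ∈ F, ∀ y ∈ F, R x y → w x ≤ w y) (θ : ℝ) :
    ∀ ω ∈ {ω : Set ι | θ ≤ ∑ i ∈ F.filter (· ∈ ω), w i}, ∀ x ∈ F, ∀ y ∈ F, R x y → x ∈ ω → y ∉ ω →
      (ω \ {x}) ∪ {y} ∈ {ω : Set ι | θ ≤ ∑ i ∈ F.filter (· ∈ ω), w i} := by
  intro ω hω x hx y hy hR hxω hyω
  simp only [Set.mem_setOf_eq] at hω ⊢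
  refine hω.trans ?_
  have hfi : F.filter (· ∈ (ω \ {x}) ∪ {y}) = insert y ((F.filter (· ∈ ω)).erase x) := by
    ext z
    simp only [Finset.mem_filter, Set.mem_union, Set.mem_sdiff, Set.mem_singleton_iff, Finset.mem_insert, Finset.mem_erase]
    constructor
    · rintro ⟨hz, ⟨hzω, hzx⟩ | rfl⟩
      · exact Or.inr ⟨hzx, hz, hzω⟩
      · exact Or.inl rfl
    · rintro (rfl | ⟨hzx, hz, hzω⟩)
      · exact ⟨hy, Or.inr rfl⟩
      · exact ⟨hz, Or.inl ⟨hzω, hzx⟩⟩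
  have hynot : y ∉ (F.filter (· ∈ ω)).erase x := fun h => hyω (Finset.mem_filter.1 (Finset.mem_erase.1 h).2).2
  have hxmem : x ∈ F.filter (· ∈ ω) := Finset.mem_filter.2 ⟨hx, hxω⟩
  have key : ∑ i ∈ F.filter (· ∈ ω), w i ≤ ∑ i ∈ F.filter (· ∈ (ω \ {x}) ∪ {y}), w i := by
    rw [hfi, Finset.sum_insert hynot, ← Finset.add_sum_erase _ _ hxmem]
    linarith [hmono x hx y hy hR]
  rw [Finset.filter_congr_decidable F (· ∈ (ω \ {x}) ∪ {y}) _]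
  exact key

end SahiOneStep

end Summit.CriticalPhenomena.PercolationContinuityZ3.Theorems
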